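import Summits.CriticalPhenomena.PercolationContinuityZ3.Theorems.SahiMasterFamilyFInequalityKappaDecomposition

/-!
# Comparability components and the reduction `(KC2) ⟹ WF_comb ≥ 0`

Support file for the master-family `F`-inequality programme (`prim-master-conj` gen 25; `--supports stmt-CriticalPhenomena-4575`;
memo `run/shared/lean/prim/prim-l12/prim-master-conj/POINTWISE.md` §26).  No `sorry`, standard axioms.  This file introduces DEFINITIONS
(the comparability-component relation of a family, the weighted cross-component antipodal count `ccWeight`, the upper hull `upHull`, and the
statement `KC2Weighted` of the gen-25 conjecture) and proves the reduction theorem.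

Setting as in `SahiMasterFamilyFInequalityAntipodalCertificate` / `…KappaDecomposition`: points `s : Finset κ`, antipode `sᶜ`, families
`Finset (Finset κ)`, `Xᶜˢ` = family of complements, weight `ω`, and
`WF(ω; A,B,G) = Σ_s ω s · [𝟙_{A∩B∩G}(s) − 𝟙_{A∩G}(s)𝟙_{B∩G}(sᶜ) − 𝟙_G(s)𝟙_{(A∩B)∖G}(sᶜ)]` (`ω ≡ 1`: `F_comb`).

* `SameComp T x y` — `x, y` are joined by a chain of comparable members of the family `T` (the comparability components of `T`).
* `ccWeight ω T = Σ_{x ∈ T, xᶜ ∈ T, ¬SameComp T x xᶜ} ω x` — twice the weight of the antipodal pairs of `T` joining different components.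
* `upHull V G = {x : ∀ y ∈ G, x ⊆ y → y ∈ V}` — the largest family meeting `G` inside `V` (upper when `V` is).
* `KC2Weighted ω` — CONJECTURE (KC2) of POINTWISE §26 for the weight `ω`: for upper families `V ⊆ E ⊆ G`,
  `ccWeight ω (E ∖ V) ≤ 2·( ω(V) − ω(upHull V G ∩ Gᶜˢ) + ω(V ∩ (G ∖ E)ᶜˢ) )`.
  STATUS: open.  Verified by computer for `ω ≡ 1`: all chains of up-sets of `{0,1}^k`, `k ≤ 4` (160,948), `k = 5, 6` sampled (3·10⁶ each), and
  the special case `E = G` ("(KC)": `#{v ∈ V : vᶜ ∉ Y} ≥ cc(Y∖V)`) for ALL 57,471,561 pairs of up-sets of `{0,1}^5`; 0 violations.  For two components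
  (KC) is Kleitman's lemma; from `k = 6` on it is strictly stronger (odd cycles of the component link graph).
* `mem_sdiff_iff_of_sameComp` — for upper `C, D`, the 2-colouring of `T = (C∪D)∖(C∩D)` into `C∖D`, `D∖C` is constant on components.
* `two_mul_sum_crossing_le_ccWeight` — hence twice the weight of the crossing antipodal pairs of `(C,D)` is at most `ccWeight ω T`.
* `weightedFcomb_nonneg_of_KC2` — **REDUCTION THEOREM**: `KC2Weighted ω` implies `WF(ω; A,B,G) ≥ 0` for all upper families `A, B, G` and every
  nonnegative complement-invariant `ω` (no lattice condition needed for the reduction), via `weightedFcomb_eq_kappa_decomposition`.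

HONEST FRAMING: the theorem is a reduction to an UNPROVED conjecture (stated here as a definition, used as a hypothesis); `F ≥ 0` remains OPEN. [this work]
-/

namespace Summit.CriticalPhenomena.PercolationContinuityZ3.Theorems

namespace TwistedAD

open Finset
open scoped FinsetFamily Classical

variable {κ : Type*} [Fintype κ] [DecidableEq κ]

/-- One comparability step inside the family `T`: both points lie in `T` and are `⊆`-comparable. [this work] -/
def CompStep (T : Finset (Finset κ)) (x y : Finset κ) : Prop := x ∈ T ∧ y ∈ T ∧ (x ⊆ y ∨ y ⊆ x)

/-- `x` and `y` lie in the same comparability component of the family `T` (equivalence closure of `CompStep T`). [this work] -/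
def SameComp (T : Finset (Finset κ)) (x y : Finset κ) : Prop := Relation.EqvGen (CompStep T) x y

/-- Twice the weight of the antipodal pairs `{x, xᶜ} ⊆ T` whose two points lie in DIFFERENT comparability components of `T`
(each such pair contributes `ω x + ω xᶜ`). [this work] -/
noncomputable def ccWeight (ω : Finset κ → ℝ) (T : Finset (Finset κ)) : ℝ :=
  ∑ x ∈ T, (if xᶜ ∈ T ∧ ¬ SameComp T x xᶜ then ω x else 0)

/-- The upper hull of `V` relative to `G`: all `x` every `G`-member above which lies in `V` (the largest family `H` with `H ∩ G ⊆ V` when `V ⊆ G`;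
upper when `V` is). [this work] -/
def upHull (V G : Finset (Finset κ)) : Finset (Finset κ) := univ.filter (fun x => ∀ y ∈ G, x ⊆ y → y ∈ V)

/-- **CONJECTURE (KC2), weighted form** (POINTWISE §26; STATUS: open, computer-verified for `ω ≡ 1` in dimension ≤ 5 as described in the module
docstring).  For upper families `V ⊆ E ⊆ G`:
`ccWeight ω (E ∖ V) ≤ 2·( Σ_V ω − Σ_{upHull V G ∩ Gᶜˢ} ω + Σ_{V ∩ (G∖E)ᶜˢ} ω )`.
In words (`ω ≡ 1`): the number of antipodal pairs `{v, vᶜ}` with `v ∈ V`, `vᶜ ∉ E` is at least the number of cross-component antipodal pairs of `E∖V`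
plus the number of pairs `{h, hᶜ}` with `h ∈ upHull V G ∖ G`, `hᶜ ∈ G`. [this work] -/
def KC2Weighted (ω : Finset κ → ℝ) : Prop :=
  ∀ V E G : Finset (Finset κ), IsUpperSet (V : Set (Finset κ)) → IsUpperSet (E : Set (Finset κ)) → IsUpperSet (G : Set (Finset κ)) →
    V ⊆ E → E ⊆ G →
    ccWeight ω (E \ V) ≤ 2 * ((∑ s ∈ V, ω s) - (∑ s ∈ upHull V G ∩ Gᶜˢ, ω s) + ∑ s ∈ V ∩ (G \ E)ᶜˢ, ω s)

/-! ### Colourings by two upper families are constant on components -/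

omit [Fintype κ] in
/-- One step: for upper `C, D` and `T = (C ∪ D) ∖ (C ∩ D)`, a comparability step inside `T` preserves membership in `C ∖ D`. [this work] -/
theorem mem_sdiff_iff_of_compStep (C D : Finset (Finset κ)) (hC : IsUpperSet (C : Set (Finset κ))) (hD : IsUpperSet (D : Set (Finset κ)))
    {x y : Finset κ} (h : CompStep ((C ∪ D) \ (C ∩ D)) x y) : (x ∈ C \ D ↔ y ∈ C \ D) := by
  obtain ⟨hx, hy, hxy⟩ := h
  simp only [mem_sdiff, mem_union, mem_inter, not_and] at hx hy
  -- hx : (x ∈ C ∨ x ∈ D) ∧ (x ∈ C → x ∉ D), similarly hy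
  have key : ∀ {a b : Finset κ}, ((a ∈ C ∨ a ∈ D) ∧ (a ∈ C → a ∉ D)) → ((b ∈ C ∨ b ∈ D) ∧ (b ∈ C → b ∉ D)) → a ⊆ b →
      (a ∈ C \ D ↔ b ∈ C \ D) := by
    intro a b ha hb hab
    constructor
    · intro haCD
      rw [mem_sdiff] at haCD ⊢
      have hbC : b ∈ C := hC hab haCD.1
      exact ⟨hbC, hb.2 hbC⟩
    · intro hbCD
      rw [mem_sdiff] at hbCD ⊢
      rcases ha.1 with haC | haD
      · exact ⟨haC, ha.2 haC⟩
      · exact absurd (hD hab haD) hbCD.2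
  rcases hxy with hxy | hyx
  · exact key hx hy hxy
  · exact (key hy hx hyx).symm

omit [Fintype κ] in
/-- For upper `C, D`, points of `T = (C ∪ D) ∖ (C ∩ D)` in the same comparability component of `T` are on the same side (`C ∖ D` versus `D ∖ C`). [this work] -/
theorem mem_sdiff_iff_of_sameComp (C D : Finset (Finset κ)) (hC : IsUpperSet (C : Set (Finset κ))) (hD : IsUpperSet (D : Set (Finset κ)))
    {x y : Finset κ} (h : SameComp ((C ∪ D) \ (C ∩ D)) x y) : (x ∈ C \ D ↔ y ∈ C \ D) := by
  induction h with
  | rel a b hab => exact mem_sdiff_iff_of_compStep C D hC hD hab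
  | refl a => exact Iff.rfl
  | symm a b _ ih => exact ih.symm
  | trans a b c _ _ ih1 ih2 => exact ih1.trans ih2

/-! ### Crossing pairs are cross-component pairs -/

/-- **Crossing pairs of `(C, D)` are cross-component antipodal pairs of `T = (C∪D)∖(C∩D)`.**  For upper `C, D` and a nonnegative
complement-invariant weight: `2 · Σ_{(C∖D) ∩ (D∖C)ᶜˢ} ω ≤ ccWeight ω ((C ∪ D) ∖ (C ∩ D))`. [this work] -/
theorem two_mul_sum_crossing_le_ccWeight (ω : Finset κ → ℝ) (hω₀ : ∀ s, 0 ≤ ω s) (hsym : ∀ s, ω sᶜ = ω s)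
    (C D : Finset (Finset κ)) (hC : IsUpperSet (C : Set (Finset κ))) (hD : IsUpperSet (D : Set (Finset κ))) :
    2 * ∑ s ∈ (C \ D) ∩ (D \ C)ᶜˢ, ω s ≤ ccWeight ω ((C ∪ D) \ (C ∩ D)) := by
  set T : Finset (Finset κ) := (C ∪ D) \ (C ∩ D) with hT
  set X : Finset (Finset κ) := (C \ D) ∩ (D \ C)ᶜˢ with hX
  set X' : Finset (Finset κ) := (D \ C) ∩ (C \ D)ᶜˢ with hX'
  -- X' is the complement image of X, so it has the same weight
  have hXX' : ∑ s ∈ X', ω s = ∑ s ∈ X, ω s := by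
    have himg : X' = Xᶜˢ := by
      ext s
      simp only [hX, hX', mem_inter, mem_compls, mem_sdiff, compl_compl]
      tauto
    rw [himg]
    exact sum_compls_eq ω hsym X
  -- X and X' are disjoint subsets of T, and their points are cross-component points
  have hXT : ∀ s ∈ X, s ∈ T ∧ sᶜ ∈ T ∧ ¬ SameComp T s sᶜ := by
    intro s hs
    simp only [hX, mem_inter, mem_compls, mem_sdiff] at hs
    obtain ⟨⟨hsC, hsD⟩, hscD, hscC⟩ := hs
    refine ⟨?_, ?_, ?_⟩
    · rw [hT, mem_sdiff, mem_union, mem_inter]; exact ⟨Or.inl hsC, fun h => hsD h.2⟩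
    · rw [hT, mem_sdiff, mem_union, mem_inter]; exact ⟨Or.inr hscD, fun h => hscC h.1⟩
    · intro hsame
      have := (mem_sdiff_iff_of_sameComp C D hC hD hsame).1 (mem_sdiff.2 ⟨hsC, hsD⟩)
      exact (mem_sdiff.1 this).2 hscD
  have hX'T : ∀ s ∈ X', s ∈ T ∧ sᶜ ∈ T ∧ ¬ SameComp T s sᶜ := by
    intro s hs
    simp only [hX', mem_inter, mem_compls, mem_sdiff] at hs
    obtain ⟨⟨hsD, hsC⟩, hscC, hscD⟩ := hs
    refine ⟨?_, ?_, ?_⟩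
    · rw [hT, mem_sdiff, mem_union, mem_inter]; exact ⟨Or.inr hsD, fun h => hsC h.1⟩
    · rw [hT, mem_sdiff, mem_union, mem_inter]; exact ⟨Or.inl hscC, fun h => hscD h.2⟩
    · intro hsame
      have := (mem_sdiff_iff_of_sameComp C D hC hD hsame).2 (mem_sdiff.2 ⟨hscC, hscD⟩)
      exact (mem_sdiff.1 this).2 hsD
  have hdisj : Disjoint X X' := by
    rw [disjoint_left]
    intro s hs hs'
    simp only [hX, mem_inter, mem_sdiff] at hs
    simp only [hX', mem_inter, mem_sdiff] at hs'
    exact hs.1.2 hs'.1.1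
  -- pointwise comparison of the two sums over T
  have hsub : X ∪ X' ⊆ T := by
    intro s hs
    rcases mem_union.1 hs with h | h
    · exact (hXT s h).1
    · exact (hX'T s h).1
  have hle : ∑ s ∈ X ∪ X', ω s ≤ ccWeight ω T := by
    have hcond : ∀ s ∈ X ∪ X', sᶜ ∈ T ∧ ¬ SameComp T s sᶜ := by
      intro s hs
      rcases mem_union.1 hs with h | h
      · exact ⟨(hXT s h).2.1, (hXT s h).2.2⟩
      · exact ⟨(hX'T s h).2.1, (hX'T s h).2.2⟩
    unfold ccWeight
    calc ∑ s ∈ X ∪ X', ω s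
        = ∑ s ∈ X ∪ X', (if sᶜ ∈ T ∧ ¬ SameComp T s sᶜ then ω s else 0) :=
          sum_congr rfl fun s hs => by rw [if_pos (hcond s hs)]
      _ ≤ ∑ s ∈ T, (if sᶜ ∈ T ∧ ¬ SameComp T s sᶜ then ω s else 0) := by
          refine sum_le_sum_of_subset_of_nonneg hsub fun s _ _ => ?_
          split_ifs
          · exact hω₀ s
          · exact le_refl _
  rw [sum_union hdisj, hXX'] at hle
  linarith

/-! ### The reduction theorem -/

/-- The upper hull contains every upper family meeting `G` inside `V`: if `W` is upper and `W ∩ G ⊆ V` then `W ⊆ upHull V G`. [this work] -/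
theorem subset_upHull_of_upper (V G W : Finset (Finset κ)) (hW : IsUpperSet (W : Set (Finset κ))) (hWG : W ∩ G ⊆ V) :
    W ⊆ upHull V G := by
  intro x hx
  rw [upHull, mem_filter]
  refine ⟨mem_univ x, fun y hy hxy => hWG (mem_inter.2 ⟨hW hxy hx, hy⟩)⟩

/-- **REDUCTION THEOREM `(KC2) ⟹ WF_comb ≥ 0`.**  Let `ω ≥ 0` be complement-invariant and assume the conjecture `KC2Weighted ω`.  Then for all
upper families `A, B, G`:
`0 ≤ Σ_s ω s·[𝟙_{A∩B∩G}(s) − 𝟙_{A∩G}(s)𝟙_{B∩G}(sᶜ) − 𝟙_G(s)𝟙_{(A∩B)∖G}(sᶜ)]`.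
Proof: `weightedFcomb_eq_kappa_decomposition` writes the sum as `[ω((A∩B)∩G) − ω((A∩B)∩Gᶜˢ)] + ω(V∩(G∖(A∪B))ᶜˢ) − ω(crossing)`
with `V = A∩B∩G`; `A∩B ⊆ upHull V G` bounds the second term, `two_mul_sum_crossing_le_ccWeight` (with `C = A∩G`, `D = B∩G`, so
`(C∪D)∖(C∩D) = E∖V`, `E = (A∪B)∩G`) bounds the crossing term by `ccWeight/2`, and `KC2Weighted` applied to `V ⊆ E ⊆ G` closes the estimate.
CONDITIONAL on the open conjecture (KC2). [this work] -/
theorem weightedFcomb_nonneg_of_KC2 (ω : Finset κ → ℝ) (hω₀ : ∀ s, 0 ≤ ω s) (hsym : ∀ s, ω sᶜ = ω s)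
    (hKC2 : KC2Weighted ω)
    (A B G : Finset (Finset κ)) (hA : IsUpperSet (A : Set (Finset κ))) (hB : IsUpperSet (B : Set (Finset κ)))
    (hG : IsUpperSet (G : Set (Finset κ))) :
    0 ≤ ∑ s, ω s * ((if s ∈ A ∩ B ∩ G then (1 : ℝ) else 0) - (if s ∈ A ∩ G then (1 : ℝ) else 0) * (if sᶜ ∈ B ∩ G then 1 else 0)
              - (if s ∈ G then (1 : ℝ) else 0) * (if sᶜ ∈ (A ∩ B) \ G then 1 else 0)) := by
  rw [weightedFcomb_eq_kappa_decomposition ω hsym A B G]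
  -- the three upper families V ⊆ E ⊆ G
  set V : Finset (Finset κ) := A ∩ B ∩ G with hV
  set E : Finset (Finset κ) := (A ∪ B) ∩ G with hE
  have hAB : IsUpperSet ((A ∩ B : Finset (Finset κ)) : Set (Finset κ)) := by
    rw [coe_inter]; exact hA.inter hB
  have hVup : IsUpperSet (V : Set (Finset κ)) := by
    rw [hV, coe_inter, coe_inter]; exact (hA.inter hB).inter hG
  have hEup : IsUpperSet (E : Set (Finset κ)) := by
    rw [hE, coe_inter, coe_union]; exact (hA.union hB).inter hG
  have hVE : V ⊆ E := by
    intro s hs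
    simp only [hV, hE, mem_inter, mem_union] at hs ⊢
    exact ⟨Or.inl hs.1.1, hs.2⟩
  have hEG : E ⊆ G := fun s hs => (mem_inter.1 hs).2
  have key := hKC2 V E G hVup hEup hG hVE hEG
  -- (1) κ term: A∩B ⊆ upHull V G
  have hsubH : A ∩ B ⊆ upHull V G :=
    subset_upHull_of_upper V G (A ∩ B) hAB (by rw [hV])
  have h1 : ∑ s ∈ (A ∩ B) ∩ Gᶜˢ, ω s ≤ ∑ s ∈ upHull V G ∩ Gᶜˢ, ω s :=
    sum_le_sum_of_subset_of_nonneg (inter_subset_inter hsubH le_rfl) fun s _ _ => hω₀ s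
  have h1' : ∑ s ∈ (A ∩ B) ∩ G, ω s = ∑ s ∈ V, ω s := by rw [hV]
  -- (2) middle term: G \ (A ∪ B) = G \ E
  have h2 : (A ∩ B ∩ G) ∩ (G \ (A ∪ B))ᶜˢ = V ∩ (G \ E)ᶜˢ := by
    have : G \ (A ∪ B) = G \ E := by
      ext s
      simp only [hE, mem_sdiff, mem_inter, mem_union, not_and, not_or]
      constructor
      · rintro ⟨hsG, hsA, hsB⟩; exact ⟨hsG, fun h _ => h.elim hsA hsB⟩
      · rintro ⟨hsG, h⟩
        by_cases hsA : s ∈ A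
        · exact absurd hsG (h (Or.inl hsA))
        · by_cases hsB : s ∈ B
          · exact absurd hsG (h (Or.inr hsB))
          · exact ⟨hsG, hsA, hsB⟩
    rw [this, hV]
  -- (3) crossing term: C = A ∩ G, D = B ∩ G
  have hC : IsUpperSet ((A ∩ G : Finset (Finset κ)) : Set (Finset κ)) := by rw [coe_inter]; exact hA.inter hG
  have hD : IsUpperSet ((B ∩ G : Finset (Finset κ)) : Set (Finset κ)) := by rw [coe_inter]; exact hB.inter hG
  have hcross := two_mul_sum_crossing_le_ccWeight ω hω₀ hsym (A ∩ G) (B ∩ G) hC hD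
  have hT : ((A ∩ G) ∪ (B ∩ G)) \ ((A ∩ G) ∩ (B ∩ G)) = E \ V := by
    rw [hE, hV]
    ext s
    simp only [mem_sdiff, mem_union, mem_inter, not_and]
    tauto
  have hXeq : ((A ∩ G) \ B) ∩ ((B ∩ G) \ A)ᶜˢ = ((A ∩ G) \ (B ∩ G)) ∩ ((B ∩ G) \ (A ∩ G))ᶜˢ := by
    ext s
    simp only [mem_inter, mem_sdiff, mem_compls, not_and]
    constructor
    · rintro ⟨⟨⟨hsA, hsG⟩, hsB⟩, ⟨hcB, hcG⟩, hcA⟩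
      exact ⟨⟨⟨hsA, hsG⟩, fun hB' _ => hsB hB'⟩, ⟨hcB, hcG⟩, fun hA' _ => hcA hA'⟩
    · rintro ⟨⟨⟨hsA, hsG⟩, hsB⟩, ⟨hcB, hcG⟩, hcA⟩
      exact ⟨⟨⟨hsA, hsG⟩, fun hB' => hsB hB' hsG⟩, ⟨hcB, hcG⟩, fun hA' => hcA hA' hcG⟩
  rw [hT] at hcross
  rw [← hXeq] at hcross
  have hmid : 0 ≤ ∑ s ∈ (A ∩ B ∩ G) ∩ (G \ (A ∪ B))ᶜˢ, ω s := sum_nonneg fun s _ => hω₀ s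
  rw [h2] at hmid ⊢
  rw [h1']
  linarith

end TwistedAD

end Summit.CriticalPhenomena.PercolationContinuityZ3.Theorems
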